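import Summits.QuantumAdvantage.AdviceFreeQNC0.OddPrimeTransport
import Mathlib.Algebra.BigOperators.Group.Finset.Powerset
import HarnessLib

/-!
# Cell qa-qnc0 / decomp-qadv (odd primes, rung F-Q1): `walkHardF_subLog` — the u-walk game is hard for cuts of
# `𝔽_p`-degree `d` whenever `2^d < p` (every prime `p`), by CHARACTERISTIC TRANSFER to α

TREE-READY TWIN of the node `HOME/decomp-qadv-lens-6/g7/CharDial.lean` (decomp-qadv-lens-6 g7): ZERO `def … : Prop`;
the statements are inlined.  Content:

* the Möbius (iterated finite-difference) calculus on the cube `{0,1}ⁿ` (`SubLog.moeb`): splitting identity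
  `μ_{S∪{i}}(g) = μ_S(g|_{xᵢ=1}) − μ_S(g)`, inversion `Σ_{S⊆Y} μ_S(g) = g(1_Y)`, representation `g = Σ_S μ_S(g)·x_S`,
  and the DEGREE TEST `g ∈ lowDeg F n d → μ_S(g) = 0 (|S| > d)` (uses only that `lowDeg` is the span of the
  monomials — no linear independence);
* the INTEGRALITY LEMMA: a Boolean `f` with `HasDegF p f d` and `2^d < p` has all integer Möbius coefficients of
  order `> d` equal to `0` (they are `≡ 0 mod p` and bounded by `2^d` in absolute value);
* `hasDegF_transfer : 2^d < p → HasDegF p f d → HasDegF q f d` for any two primes;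
* `walkHardF_subLog : 2^d < p → (∃ θ < 1, ∃ n₀, ∀ n ≥ n₀, ∀ c y, (∀ g, HasDegF p (y g) d) → #win ≤ θ·2ⁿ)` — α's
  `walkHardF_two` transferred (`d ≤ log₂ n` for `n ≥ 2^d`, exponent `C = 1`).

Landing suggestion (prover lane): `ledger propose --kind proof --target
Summits/QuantumAdvantage/AdviceFreeQNC0/WalkHardFSubLog.lean` (supports the odd-prime walk crux family; cite
`--supports` the CharDial route items once the writer files them).  WHAT THIS IS NOT: nothing at degree `≥ log₂ p`;
no claim on `WalkHardF p`, `p ≥ 5`.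
-/

noncomputable section

namespace Summit.QuantumAdvantage.AdviceFreeQNC0

namespace SubLog

open Finset
open Literature.Computability.MetaComplexity Literature.Computability.MetaComplexity.Smolensky

variable {n : ℕ}

/-! ### §1 The Möbius (iterated finite-difference) functional on the cube -/

/-- The vertex `1_T ∈ {0,1}ⁿ` of a set `T` of coordinates. -/
def vert (T : Finset (Fin n)) : Fin n → Bool := fun i => decide (i ∈ T)

/-- CharDial sub-characteristic helper `vert_insert` (lens-6 g8 LAND package; see the module docstring). -/
theorem vert_insert (T : Finset (Fin n)) (i : Fin n) :
    vert (insert i T) = Function.update (vert T) i true := by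
  funext j
  by_cases h : j = i
  · subst h; simp [vert]
  · rw [Function.update_of_ne h]; simp [vert, h]

/-- `μ_S(g) = Σ_{T ⊆ S} (−1)^{|S|−|T|} g(1_T)` — the Möbius coefficient of `g` at `S` (the iterated difference
`Δ_S g(0)`; for a multilinear polynomial it is the coefficient of `x_S`). -/
def moeb {R : Type*} [CommRing R] (g : (Fin n → Bool) → R) (S : Finset (Fin n)) : R :=
  ∑ T ∈ S.powerset, (-1 : R) ^ (S.card - T.card) * g (vert T)

/-- Restriction `xᵢ := 1`. -/
def setT {R : Type*} (i : Fin n) (g : (Fin n → Bool) → R) : (Fin n → Bool) → R :=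
  fun x => g (Function.update x i true)

section Ring

variable {R : Type*} [CommRing R]

/-- CharDial sub-characteristic helper `moeb_add` (lens-6 g8 LAND package; see the module docstring). -/
theorem moeb_add (g h : (Fin n → Bool) → R) (S : Finset (Fin n)) :
    moeb (g + h) S = moeb g S + moeb h S := by
  simp only [moeb, Pi.add_apply, mul_add, Finset.sum_add_distrib]

/-- CharDial sub-characteristic helper `moeb_sub` (lens-6 g8 LAND package; see the module docstring). -/
theorem moeb_sub (g h : (Fin n → Bool) → R) (S : Finset (Fin n)) :
    moeb (g - h) S = moeb g S - moeb h S := by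
  simp only [moeb, Pi.sub_apply, mul_sub, Finset.sum_sub_distrib]

/-- CharDial sub-characteristic helper `moeb_smul` (lens-6 g8 LAND package; see the module docstring). -/
theorem moeb_smul (a : R) (g : (Fin n → Bool) → R) (S : Finset (Fin n)) :
    moeb (a • g) S = a * moeb g S := by
  simp only [moeb, Pi.smul_apply, smul_eq_mul, Finset.mul_sum, mul_left_comm]

/-- CharDial sub-characteristic helper `moeb_empty` (lens-6 g8 LAND package; see the module docstring). -/
theorem moeb_empty (g : (Fin n → Bool) → R) : moeb g ∅ = g (vert ∅) := by
  simp [moeb]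

/-- **Splitting identity** `μ_{S ∪ {i}}(g) = μ_S(g|_{xᵢ=1}) − μ_S(g)` (`i ∉ S`). -/
theorem moeb_insert {i : Fin n} {S : Finset (Fin n)} (hi : i ∉ S) (g : (Fin n → Bool) → R) :
    moeb g (insert i S) = moeb (setT i g) S - moeb g S := by
  classical
  unfold moeb
  rw [Finset.sum_powerset_insert hi, Finset.card_insert_of_notMem hi]
  have h1 : ∑ T ∈ S.powerset, (-1 : R) ^ (S.card + 1 - T.card) * g (vert T) =
      -∑ T ∈ S.powerset, (-1 : R) ^ (S.card - T.card) * g (vert T) := by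
    rw [← Finset.sum_neg_distrib]
    refine Finset.sum_congr rfl fun T hT => ?_
    have hle : T.card ≤ S.card := Finset.card_le_card (Finset.mem_powerset.1 hT)
    rw [show S.card + 1 - T.card = (S.card - T.card) + 1 by omega, pow_succ]
    ring
  have h2 : ∑ T ∈ S.powerset, (-1 : R) ^ (S.card + 1 - (insert i T).card) * g (vert (insert i T)) =
      ∑ T ∈ S.powerset, (-1 : R) ^ (S.card - T.card) * setT i g (vert T) := by
    refine Finset.sum_congr rfl fun T hT => ?_
    have hT' : T ⊆ S := Finset.mem_powerset.1 hT
    have hiT : i ∉ T := fun h => hi (hT' h)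
    have hle : T.card ≤ S.card := Finset.card_le_card hT'
    rw [Finset.card_insert_of_notMem hiT, vert_insert,
      show S.card + 1 - (T.card + 1) = S.card - T.card by omega]
    rfl
  rw [h1, h2]
  ring

/-- **Möbius inversion on the cube**: `Σ_{S ⊆ Y} μ_S(g) = g(1_Y)`. -/
theorem sum_moeb_powerset (g : (Fin n → Bool) → R) (Y : Finset (Fin n)) :
    ∑ S ∈ Y.powerset, moeb g S = g (vert Y) := by
  classical
  induction Y using Finset.induction_on generalizing g with
  | empty => simp [moeb_empty]
  | insert i Y hi ih =>
    rw [Finset.sum_powerset_insert hi, ih]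
    have h2 : ∑ S ∈ Y.powerset, moeb g (insert i S) =
        ∑ S ∈ Y.powerset, (moeb (setT i g) S - moeb g S) :=
      Finset.sum_congr rfl fun S hS => moeb_insert (fun h => hi (Finset.mem_powerset.1 hS h)) g
    rw [h2, Finset.sum_sub_distrib, ih, ih, vert_insert]
    simp [setT]

/-- Crude size bound: `|μ_S(g)| ≤ 2^{|S|}` for `|g| ≤ 1` pointwise. -/
theorem abs_moeb_le (g : (Fin n → Bool) → ℤ) (hg : ∀ x, |g x| ≤ 1) (S : Finset (Fin n)) :
    |moeb g S| ≤ 2 ^ S.card := by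
  unfold moeb
  calc |∑ T ∈ S.powerset, (-1 : ℤ) ^ (S.card - T.card) * g (vert T)|
      ≤ ∑ T ∈ S.powerset, |(-1 : ℤ) ^ (S.card - T.card) * g (vert T)| :=
        Finset.abs_sum_le_sum_abs _ _
    _ ≤ ∑ T ∈ S.powerset, (1 : ℤ) := Finset.sum_le_sum fun T _ => by
        rw [abs_mul, abs_pow, abs_neg, abs_one, one_pow, one_mul]; exact hg _
    _ = 2 ^ S.card := by simp [Finset.card_powerset]

end Ring

/-! ### §2 Möbius coefficients of low-degree functions vanish (no uniqueness of representation needed) -/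

section Field

variable {F : Type*} [Field F]

/-- CharDial sub-characteristic helper `setT_mono` (lens-6 g8 LAND package; see the module docstring). -/
theorem setT_mono (i : Fin n) (A : Finset (Fin n)) : setT i (mono F A) = mono F (A.erase i) := by
  classical
  funext x
  simp only [setT, mono_apply]
  apply if_congr _ rfl rfl
  constructor
  · intro h j hj
    have hji : j ≠ i := Finset.ne_of_mem_erase hj
    have := h j (Finset.mem_of_mem_erase hj)
    rwa [Function.update_of_ne hji] at this
  · intro h j hj
    by_cases hji : j = i
    · subst hji; simp
    · rw [Function.update_of_ne hji]; exact h j (Finset.mem_erase.2 ⟨hji, hj⟩)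

/-- `μ_S(x_A) = [A = S]`. -/
theorem moeb_mono (A S : Finset (Fin n)) : moeb (mono F A) S = if A = S then 1 else 0 := by
  classical
  induction S using Finset.induction_on generalizing A with
  | empty =>
    rw [moeb_empty, mono_apply]
    by_cases hA : A = ∅
    · simp [hA]
    · rw [if_neg, if_neg hA]
      obtain ⟨j, hj⟩ := Finset.nonempty_iff_ne_empty.2 hA
      intro h
      simpa [vert] using h j hj
  | insert i S hi ih =>
    rw [moeb_insert hi, setT_mono, ih, ih]
    by_cases hiA : i ∈ A
    · have hne : A ≠ S := fun h => hi (h ▸ hiA)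
      rw [if_neg hne, sub_zero]
      by_cases h : A = insert i S
      · rw [if_pos h, if_pos]
        rw [h, Finset.erase_insert hi]
      · rw [if_neg h, if_neg]
        intro h'
        apply h
        rw [← h', Finset.insert_erase hiA]
    · rw [Finset.erase_eq_of_notMem hiA, sub_self, if_neg]
      intro h
      apply hiA
      rw [h]
      exact Finset.mem_insert_self i S

/-- Restriction `xᵢ := 1` does not raise the degree. -/
theorem setT_mem_lowDeg (i : Fin n) {d : ℕ} {g : CubeFn F n} (hg : g ∈ lowDeg F n d) :
    setT i g ∈ lowDeg F n d := by
  classical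
  let L : CubeFn F n →ₗ[F] CubeFn F n :=
    { toFun := fun g => setT i g, map_add' := fun _ _ => rfl, map_smul' := fun _ _ => rfl }
  have hle : (lowDeg F n d).map L ≤ lowDeg F n d := by
    rw [lowDeg_eq_span (D := d), Submodule.map_span_le]
    rintro _ ⟨⟨A, hA⟩, rfl⟩
    show setT i (mono F A) ∈ _
    rw [setT_mono]
    exact mono_mem_lowDeg ((Finset.card_erase_le).trans hA)
  exact hle (Submodule.mem_map_of_mem hg)

/-- **Degree test**: every `g ∈ lowDeg F n d` has `μ_S(g) = 0` for `|S| > d` (linearity + `μ_S(x_A) = [A = S]`;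
uses only that `lowDeg` is the SPAN of the monomials — no linear independence). -/
theorem moeb_eq_zero_of_mem_lowDeg {d : ℕ} {g : CubeFn F n} (hg : g ∈ lowDeg F n d)
    {S : Finset (Fin n)} (hS : d < S.card) : moeb g S = 0 := by
  classical
  let L : CubeFn F n →ₗ[F] F :=
    { toFun := fun g => moeb g S
      map_add' := fun g h => moeb_add g h S
      map_smul' := fun a g => by simp only [moeb_smul, RingHom.id_apply, smul_eq_mul] }
  have hle : lowDeg F n d ≤ LinearMap.ker L := by
    rw [lowDeg_eq_span (D := d), Submodule.span_le]
    rintro _ ⟨⟨A, hA⟩, rfl⟩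
    show moeb (mono F A) S = 0
    rw [moeb_mono, if_neg]
    rintro rfl
    omega
  exact hle hg

/-- **Möbius representation**: every function on the cube is `Σ_S μ_S(g) · x_S`. -/
theorem eq_sum_moeb_smul_mono (g : CubeFn F n) :
    g = ∑ S : Finset (Fin n), moeb g S • mono F S := by
  classical
  funext x
  simp only [Finset.sum_apply, Pi.smul_apply, smul_eq_mul]
  set Y : Finset (Fin n) := univ.filter fun i => x i = true with hY
  have hx : vert Y = x := by
    funext i
    simp [vert, hY]
  have hmono : ∀ S : Finset (Fin n), mono F S x = if S ⊆ Y then 1 else 0 := by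
    intro S
    rw [mono_apply]
    apply if_congr _ rfl rfl
    simp [hY, Finset.subset_iff]
  simp_rw [hmono, mul_ite, mul_one, mul_zero]
  rw [← Finset.sum_filter]
  have hfilter : (univ.filter fun S : Finset (Fin n) => S ⊆ Y) = Y.powerset := by
    ext S
    simp
  rw [hfilter, sum_moeb_powerset, hx]

end Field

/-! ### §3 Integrality: below `log₂ p` the `𝔽_p`-degree of a BOOLEAN function is its degree in every characteristic -/

/-- Integer lift of a Boolean function. -/
def indZ (f : (Fin n → Bool) → Bool) : (Fin n → Bool) → ℤ := fun x => if f x then 1 else 0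

/-- `R`-valued indicator lift of a Boolean function (`HasDegF p f d` is `indR (ZMod p) f ∈ lowDeg (ZMod p) n d`). -/
def indR (R : Type*) [CommRing R] (f : (Fin n → Bool) → Bool) : (Fin n → Bool) → R :=
  fun x => if f x then 1 else 0

/-- CharDial sub-characteristic helper `hasDegF_iff_indR` (lens-6 g8 LAND package; see the module docstring). -/
theorem hasDegF_iff_indR (p : ℕ) [Fact p.Prime] (f : (Fin n → Bool) → Bool) (d : ℕ) :
    HasDegF p f d ↔ indR (ZMod p) f ∈ lowDeg (ZMod p) n d := Iff.rfl

/-- CharDial sub-characteristic helper `cast_moeb_indZ` (lens-6 g8 LAND package; see the module docstring). -/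
theorem cast_moeb_indZ {R : Type*} [CommRing R] (f : (Fin n → Bool) → Bool) (S : Finset (Fin n)) :
    ((moeb (indZ f) S : ℤ) : R) = moeb (indR R f) S := by
  unfold moeb
  push_cast
  refine Finset.sum_congr rfl fun T _ => ?_
  simp only [indZ, indR]
  split <;> simp

/-- `|μ_{S ∪ {i}}(f)| ≤ 2^{|S|}` for Boolean `f` (the split identity: a difference of two restrictions,
pointwise in `{−1,0,1}`). -/
theorem abs_moeb_indZ_insert_le {i : Fin n} {S : Finset (Fin n)} (hi : i ∉ S)
    (f : (Fin n → Bool) → Bool) : |moeb (indZ f) (insert i S)| ≤ 2 ^ S.card := by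
  rw [moeb_insert hi, ← moeb_sub]
  refine abs_moeb_le _ (fun x => ?_) S
  simp only [Pi.sub_apply, setT, indZ]
  split <;> split <;> simp

/-- **Integrality lemma.** If `f` is Boolean with `𝔽_p`-degree `≤ d` and `2^d < p`, then ALL integer Möbius
coefficients `μ_S(f)`, `|S| > d`, vanish: by induction on `S` via the splitting identity; at `|S| = d + 1` the
coefficient is `≡ 0 (mod p)` (degree test) and has absolute value `≤ 2^d < p`. -/
theorem moeb_indZ_eq_zero (p : ℕ) [Fact p.Prime] {d : ℕ} (hdp : 2 ^ d < p) :
    ∀ (S : Finset (Fin n)) (f : (Fin n → Bool) → Bool), HasDegF p f d → d < S.card →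
      moeb (indZ f) S = 0 := by
  classical
  intro S
  induction S using Finset.induction_on with
  | empty => intro f _ h; simp at h
  | insert i S hi ih =>
    intro f hf hcard
    rw [Finset.card_insert_of_notMem hi] at hcard
    have hf' : HasDegF p (fun x => f (Function.update x i true)) d := setT_mem_lowDeg i hf
    by_cases hlt : d < S.card
    · rw [moeb_insert hi]
      have hset : setT i (indZ f) = indZ (fun x => f (Function.update x i true)) := rfl
      rw [hset, ih _ hf' hlt, ih _ hf hlt, sub_self]
    · have hS : S.card = d := by omega
      have hmod : ((moeb (indZ f) (insert i S) : ℤ) : ZMod p) = 0 := by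
        rw [cast_moeb_indZ]
        exact moeb_eq_zero_of_mem_lowDeg hf (by rw [Finset.card_insert_of_notMem hi]; omega)
      have hdvd : (p : ℤ) ∣ moeb (indZ f) (insert i S) :=
        (ZMod.intCast_zmod_eq_zero_iff_dvd _ _).1 hmod
      have habs : |moeb (indZ f) (insert i S)| < p := by
        calc |moeb (indZ f) (insert i S)| ≤ 2 ^ S.card := abs_moeb_indZ_insert_le hi f
          _ = 2 ^ d := by rw [hS]
          _ < p := by exact_mod_cast hdp
      exact Int.eq_zero_of_abs_lt_dvd hdvd habs

/-- **Characteristic transfer below `log₂ p`** (the char-0 shadow): a Boolean function of `𝔽_p`-degree `≤ d`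
with `2^d < p` has degree `≤ d` over EVERY prime field `𝔽_q` (its integer multilinear representation has
degree `≤ d`).  In particular `HasDegF p f d → HasDegF 2 f d`. -/
theorem hasDegF_transfer {p : ℕ} [Fact p.Prime] (q : ℕ) [Fact q.Prime] {d : ℕ} (hdp : 2 ^ d < p)
    {f : (Fin n → Bool) → Bool} (hf : HasDegF p f d) : HasDegF q f d := by
  classical
  rw [hasDegF_iff_indR, eq_sum_moeb_smul_mono (indR (ZMod q) f)]
  refine Submodule.sum_mem _ fun S _ => ?_
  by_cases hS : S.card ≤ d
  · exact Submodule.smul_mem _ _ (mono_mem_lowDeg hS)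
  · have h0 : moeb (indR (ZMod q) f) S = 0 := by
      rw [← cast_moeb_indZ, moeb_indZ_eq_zero p hdp S f hf (by omega), Int.cast_zero]
    rw [h0, zero_smul]
    exact Submodule.zero_mem _



end SubLog

open Finset
open Literature.Computability.MetaComplexity Literature.Computability.MetaComplexity.Smolensky

/-- **`walkHardF_subLog`** — for every prime `p` and every `d` with `2^d < p`, a strategy all of whose cuts have
`𝔽_p`-degree `≤ d` wins the u-walk game on at most `θ·2ⁿ` inputs for `n ≥ n₀` (with α's `θ`; `n₀ = max n₀(α,1) 2^d`).
Proof: `SubLog.hasDegF_transfer` makes every cut an `𝔽₂`-polynomial of degree `≤ d ≤ log₂ n`, and `walkHardF_two`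
applies with exponent `C = 1`. -/
theorem walkHardF_subLog (p : ℕ) [Fact p.Prime] (d : ℕ) (hdp : 2 ^ d < p) :
    ∃ θ : ℝ, θ < 1 ∧ ∃ n₀ : ℕ, ∀ n ≥ n₀, ∀ c : ℕ, ∀ y : Fin (n + 1) → (Fin n → Bool) → Bool,
      (∀ g, HasDegF p (y g) d) →
        ((univ.filter fun u : Fin n → Bool => ringWinU c y u = true).card : ℝ) ≤ θ * (2 : ℝ) ^ n := by
  obtain ⟨θ, hθ, H⟩ := walkHardF_two
  obtain ⟨n₀, hn₀⟩ := H 1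
  refine ⟨θ, hθ, max n₀ (2 ^ d), fun n hn c y hy => hn₀ n (le_trans (le_max_left _ _) hn) c y fun g => ?_⟩
  have hd : d ≤ Nat.log 2 n := Nat.le_log_of_pow_le (by norm_num) (le_trans (le_max_right _ _) hn)
  exact lowDeg_mono (by simpa using hd) (SubLog.hasDegF_transfer 2 hdp (hy g))

end Summit.QuantumAdvantage.AdviceFreeQNC0

end
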